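import Literature.RingTheory.CohomologyAnnihilator.Compactness
import Literature.RingTheory.CohomologyAnnihilator.TowerRestrict
import HarnessLib

/-!
# Change of generator in the `Add`-tower and restriction of scalars into `|Add G|ₙ`

Topic: `Literature/RingTheory/CohomologyAnnihilator`.  Bookkeeping for the descent step of the
proof of [IyengarTakahashi2014, Theorem 5.4] in the vocabulary of `Compactness.lean`
(`IsRetractOfCopower G X` = "`X ∈ Add G`", `InTowerAdd G n M` = "`M ∈ |Add G|ₙ`", Lemma 4.8):
"restricting scalars along `A → A_K`, the modules of `|G'|ₙ ⊆ mod A_K` land in `|Add G|ₙ ⊆ Mod A`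
as soon as `G'|_A ∈ Add G`", after which Lemma 4.8 (`inTower_of_retract_inTowerAdd`) returns to
`|G|ₙ ∩ mod A`.

* `IsRetractOfCopower.trans` — `Add (Add G) = Add G`: if `G' ∈ Add G` and `X ∈ Add G'` then
  `X ∈ Add G` (a copower of a copower is a copower, `Finsupp.curryLinearEquiv`).
* `InTowerAdd.mono_gen` — hence `|Add G'|ₙ ⊆ |Add G|ₙ` when `G' ∈ Add G`;
  `inTowerAdd_of_inTower_of_isRetractOfCopower` — `|G'|ₙ ⊆ |Add G|ₙ`.
* `inTowerAdd_restrictScalars` — along an algebra `R → S`: if `C ∈ |G''|ₙ` over `S` and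
  `G''|_R ∈ Add G` then `C|_R ∈ |Add G|ₙ` over `R` (`InTower.restrictScalars` of
  `TowerRestrict.lean`).
* `inTower_of_retract_restrictScalars` — with Lemma 4.8: if moreover `R` is noetherian, `G` is
  finitely generated and a finitely generated `M` is a retract of `C|_R`, then `M ∈ |G|ₙ`.  This is
  the form in which the descent consumes `IsSyzygy.baseChange` (`SyzygyBaseChange.lean`) and
  `exists_retract_restrictScalars_baseChange` (`BaseChangeRetract.lean`).

## References

* S. B. Iyengar, R. Takahashi, *Annihilation of cohomology and strong generation of module
  categories*, IMRN 2016; arXiv:1404.1476 — §4 (A compactness argument), Lemma 4.8, proof of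
  Theorem 5.4. [`IyengarTakahashi2014`]
-/

noncomputable section

open CategoryTheory

universe u

namespace Literature.RingTheory.CohomologyAnnihilator

variable {A : Type u} [CommRing A]

/-- **`Add (Add G) = Add G`**: a retract of a copower of a retract of a copower of `G` is a
retract of a copower of `G` (`(ι →₀ (κ →₀ G)) ≅ (ι × κ →₀ G)`).
[cite: IyengarTakahashi2014, §4 (A compactness argument)] -/
theorem IsRetractOfCopower.trans {G G' X : ModuleCat.{u} A} (hG : IsRetractOfCopower G G')
    (hX : IsRetractOfCopower G' X) : IsRetractOfCopower G X := by
  obtain ⟨κ, iG, pG, hGip⟩ := hG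
  obtain ⟨ι, iX, pX, hXip⟩ := hX
  let j : ModuleCat.of A (ι →₀ (G' : Type u)) ⟶ ModuleCat.of A (ι →₀ (κ →₀ (G : Type u))) :=
    ModuleCat.ofHom (Finsupp.mapRange.linearMap iG.hom)
  let q : ModuleCat.of A (ι →₀ (κ →₀ (G : Type u))) ⟶ ModuleCat.of A (ι →₀ (G' : Type u)) :=
    ModuleCat.ofHom (Finsupp.mapRange.linearMap pG.hom)
  have hjq : j ≫ q = 𝟙 _ := by
    apply ModuleCat.hom_ext
    rw [ModuleCat.hom_comp, ModuleCat.hom_ofHom, ModuleCat.hom_ofHom,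
      ← Finsupp.mapRange.linearMap_comp, ← ModuleCat.hom_comp, hGip, ModuleCat.hom_id,
      Finsupp.mapRange.linearMap_id]
    rfl
  let e : ModuleCat.of A (ι × κ →₀ (G : Type u)) ≅ ModuleCat.of A (ι →₀ (κ →₀ (G : Type u))) :=
    (Finsupp.curryLinearEquiv (R := A) (M := (G : Type u)) (α := ι) (β := κ)).toModuleIso
  refine ⟨ι × κ, iX ≫ j ≫ e.inv, e.hom ≫ q ≫ pX, ?_⟩
  simp only [Category.assoc, e.inv_hom_id_assoc]
  rw [← Category.assoc j q, hjq, Category.id_comp, hXip]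

/-- **`|Add G'|ₙ ⊆ |Add G|ₙ` when `G' ∈ Add G`.** [cite: IyengarTakahashi2014, §4 (A compactness argument)] -/
theorem InTowerAdd.mono_gen {G G' : ModuleCat.{u} A} (hG : IsRetractOfCopower G G') :
    ∀ {n : ℕ} {M : ModuleCat.{u} A}, InTowerAdd G' n M → InTowerAdd G n M
  | 0, _, h => h
  | _ + 1, _, ⟨W, Y, X, hY, hX, f, g, w, hS⟩ =>
    ⟨W, Y, X, InTowerAdd.mono_gen hG hY, hG.trans hX, f, g, w, hS⟩

/-- **`|G'|ₙ ⊆ |Add G|ₙ` when `G' ∈ Add G`.** [cite: IyengarTakahashi2014, §4 (A compactness argument)] -/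
theorem inTowerAdd_of_inTower_of_isRetractOfCopower {G G' : ModuleCat.{u} A}
    (hG : IsRetractOfCopower G G') {n : ℕ} {M : ModuleCat.{u} A} (h : InTower G' n M) :
    InTowerAdd G n M :=
  InTowerAdd.mono_gen hG (inTowerAdd_of_inTower h)

section Restrict

variable {R S : Type u} [CommRing R] [CommRing S] [Algebra R S]

/-- **Restriction of scalars maps `|G''|ₙ` into `|Add G|ₙ`** when `G''|_R ∈ Add G`: the step
"viewed as `A`-modules, the members of `|G'|ₙ ⊆ mod A_K` lie in `|Add G|ₙ`" of the descent in
the proof of Theorem 5.4. [cite: IyengarTakahashi2014, Thm. 5.4 (proof)] -/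
theorem inTowerAdd_restrictScalars {G : ModuleCat.{u} R} {G'' : ModuleCat.{u} S}
    (hG : IsRetractOfCopower G ((restrictScalarsFunctor R S).obj G'')) {n : ℕ}
    {C : ModuleCat.{u} S} (h : InTower G'' n C) :
    InTowerAdd G n ((restrictScalarsFunctor R S).obj C) :=
  InTowerAdd.mono_gen hG (inTowerAdd_of_inTower (InTower.restrictScalars (R := R) h))

/-- **The descent engine** (restriction + Lemma 4.8): over a noetherian `R` with `G` finitely
generated, if `C ∈ |G''|ₙ` over `S`, `G''|_R ∈ Add G`, and a finitely generated `R`-module `M`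
is a retract of `C|_R`, then `M ∈ |G|ₙ`. [cite: IyengarTakahashi2014, Thm. 5.4 (proof), Lemma 4.8] -/
theorem inTower_of_retract_restrictScalars [IsNoetherianRing R] {G : ModuleCat.{u} R}
    [Module.Finite R G] {G'' : ModuleCat.{u} S}
    (hG : IsRetractOfCopower G ((restrictScalarsFunctor R S).obj G'')) {n : ℕ}
    {C : ModuleCat.{u} S} (hC : InTower G'' n C) {M : ModuleCat.{u} R} [Module.Finite R M]
    (i : M ⟶ (restrictScalarsFunctor R S).obj C) (p : (restrictScalarsFunctor R S).obj C ⟶ M)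
    (hip : i ≫ p = 𝟙 M) : InTower G n M :=
  inTower_of_retract_inTowerAdd (inTowerAdd_restrictScalars hG hC) i p hip

end Restrict

end Literature.RingTheory.CohomologyAnnihilator

end
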